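import Summits.Ventures.HodgeRepro.Tier4.Line2.CloseFormPartII

/-!
# Tier4/Line2/CloseForm — LINE L2: THE CLOSE FORM (R-38, lead S15981; R-39, lead L8034) — module 3 of 3: Parts III–IV,
the two named INPUTS and the target theorem `target_L2v3_of_inputs`

ONE SORRY-FREE HOME FILE under the skeleton's certificate regime (farm by name, never the gate): the statement of EACH
declared `sorry` in the cone of the line's target theorem `Line2.target_L2v3` (Skeleton.lean v0.16, FILED S14405,
sha256 149e57492cdfc1b9b085b226628060ec021bc4a90261752f8208ff5903fb9fe5 · 743) as a named `Prop`, VERBATIM, binders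
and all, and the target theorem `P_T4v3` replayed from them:

* `Input_line2_inputs_v3` — the ONE declared sorry of the skeleton (`line2_inputs_v3`, L686–L689): **NOT A PRINT — open
  mathematics** (L2's costume; CENSUS.md §K certificate);
* `Input_hK_W42` — the displayed binder `hK` of `target_L2v3` (L716–L719), the ONE printed input (W42, Borel–Harish-
  Chandra 1962 Thm 11.8 / Godement via lit-3's `Lit.BorelHarishChandra1962_Thm11_8_cocompact_hdef`): **a PRINT**;
* `target_L2v3_of_inputs (hK : Input_hK_W42) (h₁ : Input_line2_inputs_v3) : Tier4.P_T4v3` — the skeleton's assembly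
  replayed with `h₁` in place of the sorried name; certified `lean check --json --no-snap --axioms
  …Line2.CloseForm.target_L2v3_of_inputs` = [propext, Classical.choice, Quot.sound], 0 sorries.

EVERYTHING ELSE in this file is the skeleton's sorry-free code (Parts I–IV: the structures `EndoscopicInputs`,
`WeightShiftedBranch`, `Line2DatumV3`, `Line2InputsV3`, the 16 proved theorems, the abbrevs) copied VERBATIM from
Skeleton.lean v0.16 L180–L741 into the namespace `….Tier4.Line2.CloseForm`, because a HOME file cannot be imported and
the replay needs `exists_famW_P` and the structures the input statement mentions.  Diff against the skeleton's code
region (7 hunks, `diff <(sed -n '180,741p' Skeleton.lean) <(sed -n '51,$p' CloseForm.lean)`): the namespace line, the end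
line, the sorried theorem → `Input_line2_inputs_v3`, on `concl_of_v3` one sentence of docstring + the binder `(h₁ :
Input_line2_inputs_v3)` + `h₁ d hBHC` for `line2_inputs_v3 d hBHC`, and `target_L2v3` → `Input_hK_W42` +
`target_L2v3_of_inputs`; nothing else.
NOTHING CHANGES in the skeleton (R-38 (1)): Skeleton.lean v0.16 stays the line of record; the display stays a declared
sorry there.

WHAT THIS CLAIMS (R-38 (4)): a sorry-free theorem `Inputs → P_T4v3` and NO claim on `P_T4v3` (one input is NOT A PRINT).
HC_CM is NOT proved by anyone in this repository.

v0.2 (R-39, lead L8034: close forms go through the GATE; typer lint = no `instance` declarations / instance attributes):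
the two global instance-attribute lines inherited from the skeleton (on `WeightShiftedBranch.fieldKbar`; on `Line2DatumV3.fL nL cL`)
are REMOVED and the instances are supplied locally by `letI` — in the STATEMENTS of `WeightShiftedBranch.central_eq_zero_iff`
(`letI := S.fieldKbar`) and `P_of_line2_v3` (`letI := Z.fL; letI := Z.nL; letI := Z.cL`), and in the proofs of those two,
of `exists_twist_good` and of `exists_famW_P`.  The two `Input_…` defs, `concl_of_v3` and `target_L2v3_of_inputs` are
byte-identical to v0.1 (ae651d9627e9699a544f292ac2dc99e89040019ebe76f89f4657c305158595b8 · 615); no other line changes.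
(R-39, lead L8034: the close form goes through the GATE; the gate's `lint.statement-form` caps a Theorems file with
proofs at 400 lines, so the ONE close-form file of record — v0.2 = the v0.1 bytes ae651d9627e9699a544f292ac2dc99e89040019ebe76f89f4657c305158595b8 · 615
FILED S16093 with the two global instance attributes replaced by local `letI` — is split BY TOPIC into three modules whose
concatenation (imports / preamble / namespace lines aside) IS v0.2: `CloseFormPartI` (Part I), `CloseFormPartII` (Part II),
`CloseForm` (Parts III–IV: the two `Input_…` defs and `target_L2v3_of_inputs`).  Nothing mathematical changes; the
skeleton Skeleton.lean v0.16 (149e57492cdfc1b9b085b226628060ec021bc4a90261752f8208ff5903fb9fe5 · 743) stays the line of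
record, its display stays a declared sorry there.  HC_CM is NOT proved by anyone in this repository.)
-/

set_option autoImplicit false

noncomputable section

namespace Summit.Ventures.HodgeRepro.Tier4.Line2.CloseForm

open Summit.Ventures.HodgeRepro.PeriodCloser
open Summit.Ventures.HodgeRepro.Tier4.Common
open NumberField

/-! ## Part III (v0.14v3 — RULING-GATED) — the SUCCESSOR target `P_T4v3` by name: the line's FAMILY datum on the concrete
witnesses of the re-chosen quadruples, the arithmetic crux on its family face, and `target_L2v3` -/

section Target

variable {F₀ E₀ : Type} [Field F₀] [NumberField F₀] [IsGalois ℚ F₀] [IsCMField F₀]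
  [Field E₀] [NumberField E₀] [IsGalois ℚ E₀] [IsCMField E₀]

/-- **The concrete witness of `d` at level `Γ′` on the canonical domain `dom d Γ'`, from the ONE printed input**
(typer-1, ConcreteWitness / ConcreteCocompact; t4-L4-p1's `dom`) — verbatim v0.12: the `Witness` on the holomorphic
concrete forms `d.HForm Γ' (dom d Γ')` whose translates are the Hecke elements of level `Γ′`, whose Hodge pairing IS the
target's integral over `dom d Γ'`, and whose `ω_i` are the corner forms of the datum's lifts — built from the residual
bundle `d.residual_of_cocompact hΓ' hcc` (`hcc : d.IsCocompact Γ'` is what Godement's printed cocompactness gives for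
every level, `isCocompact_of_BHC`, cite-only W42). -/
noncomputable abbrev concreteW (d : Tier4.TargetData F₀ E₀)
    {Γ' : Set (Matrix (Fin 3) (Fin 3) E₀)} (hΓ' : d.IsLevel Γ') (hcc : d.IsCocompact Γ') :
    Witness (d.holoFormAlgebra Γ' (isDomain_dom d hΓ').subset_ball (isDomain_dom d hΓ').measurableSet
      (d.residual_of_cocompact hΓ' hcc).pos (d.residual_of_cocompact hΓ' hcc).fin) :=
  d.concreteWitness hΓ' (isDomain_dom d hΓ').subset_ball (isDomain_dom d hΓ').measurableSet
    (d.residual_of_cocompact hΓ' hcc)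

/-- **The re-levelled datum of `d` with the `ν`-th re-chosen quadruple** (typer-1's `TargetData.relevel`,
TargetDataV3): the `P_T4` datum with `Γ := Γ'` and `a := a' ν`; everything else (the face, the hermitian space, the
tori `Λ i`, the coordinate `s`, the corners `i₁ … i₄`) is `d`'s. -/
noncomputable abbrev releveled (d : Tier4.TargetData F₀ E₀) {Γ' : Set (Matrix (Fin 3) (Fin 3) E₀)}
    (hΓ' : d.IsLevel Γ') {ι : Type} (a' : ι → ∀ i : Fin 4, (Fin 2 → ℂ) → (↥(d.T i) → ℂ))
    (ha' : ∀ ν i, IsAlbaneseLift (d.T i) (d.Λ i) d.τ₀ d.C Γ' (a' ν i)) (ν : ι) : Tier4.TargetData F₀ E₀ :=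
  d.relevel Γ' hΓ'.1 (a' ν) (ha' ν)

/-- **The family of concrete witnesses of the re-chosen quadruples**, one per twist index `ν`, all over ONE form
algebra — the holomorphic form algebra of `d` at level `Γ'` (`holoFormAlgebra` reads the level and the ball action
`d.act` only, never the lifts or the base level, so the re-levelled datum's algebra IS `d`'s, definitionally).  The
`ν`-th witness has the corner forms of the quadruple `a' ν`; its `P` is (P) for that quadruple at level `Γ'` on `dom`. -/
noncomputable abbrev famW (d : Tier4.TargetData F₀ E₀) {Γ' : Set (Matrix (Fin 3) (Fin 3) E₀)}
    (hΓ' : d.IsLevel Γ') (hcc : d.IsCocompact Γ') {ι : Type}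
    (a' : ι → ∀ i : Fin 4, (Fin 2 → ℂ) → (↥(d.T i) → ℂ))
    (ha' : ∀ ν i, IsAlbaneseLift (d.T i) (d.Λ i) d.τ₀ d.C Γ' (a' ν i)) :
    ι → Witness (d.holoFormAlgebra Γ' (isDomain_dom d hΓ').subset_ball (isDomain_dom d hΓ').measurableSet
      (d.residual_of_cocompact hΓ' hcc).pos (d.residual_of_cocompact hΓ' hcc).fin) :=
  fun ν => concreteW (releveled d hΓ' a' ha' ν) (Tier4.TargetData.isLevel_self _) hcc

/-- **The line's FAMILY datum on a datum `d` of the successor target** (v0.14v3; CENSUS.md §G2′; v0.16: the printed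
input is the PARAMETER `hBHC` — W42, lit-3's `Lit.BorelHarishChandra1962_Thm11_8_cocompact_hdef` on the datum's
`(E₀, H, τ₀, C)` — and the cocompactness of the level is DERIVED from it, `Line2DatumV3.hcc`, no longer a field): a level
`Γ′ ≤ Γ` (its ball action cocompact by Godement, `isCocompact_of_BHC`), the CM field `L = E′` of the seesaw side,
an index set `ι` (on honest data: the anticyclotomic twists `Xi 𝔭` of the face at the split prime `𝔭`), the RE-CHOSEN
QUADRUPLES `a' ν` — Albanese lifts at level `Γ′` INTO THE GIVEN tori `ℂ^{T i}/Λ i` (the `ν`-twisted corner lifts pushed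
forward along the CM isogeny into the given lattice: `Tier4.isAlbaneseLift_diag_comp`, Tier4/Line2/IsogenyPushforward
p676075) — with N2 for every member (`hN2`), the endoscopic side `E` on the FAMILY of concrete witnesses `famW` (typer-2's
`EndoscopicSideFam`, Tier4/Common/AutomorphicFam p675246: the unitary group `U(W)` of the definite hermitian `2`-space
over `E′`, shared; the four characters of the `ν`-th member = the `ν`-twisted characters `χ′_j ν`) and the Tier-3
ENDOSCOPIC INPUTS of the FAMILY FACE `E.toC7Face` (`Datum := Σ ν, (famW … ν).Translates`): the seesaw identification
(per member, `identification_of_forall`), TP1, the local discharge, the admissible family — whose `twist_mem` is now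
REALISED, the `ν`-twist of the member `⟨ν', γ⟩` being the member `⟨ν' ν, γ⟩` of the family (on a fixed-witness face it
was satisfiable only with junk `chars`: CENSUS.md §F′.4) — the product formula and the sign flip (`EndoscopicInputs`,
unchanged from v0.12).  Every content lemma of Parts I–II is a statement over an arbitrary `C7Face L` and applies to the
family face verbatim. -/
structure Line2DatumV3 (d : Tier4.TargetData F₀ E₀)
    (hBHC : Lit.BorelHarishChandra1962_Thm11_8_cocompact_hdef E₀ d.H d.τ₀ d.C) where
  /-- the level `Γ′ ≤ Γ` -/
  Γ' : Set (Matrix (Fin 3) (Fin 3) E₀)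
  hΓ' : d.IsLevel Γ'
  /-- the CM field of the seesaw side -/
  L : Type
  [fL : Field L]
  [nL : NumberField L]
  [cL : IsCMField L]
  /-- the index set of the twist family -/
  ι : Type
  /-- the re-chosen quadruples: Albanese lifts at level `Γ′` into the GIVEN tori -/
  a' : ι → ∀ i : Fin 4, (Fin 2 → ℂ) → (↥(d.T i) → ℂ)
  ha' : ∀ ν i, IsAlbaneseLift (d.T i) (d.Λ i) d.τ₀ d.C Γ' (a' ν i)
  /-- N2 (the `hN2[Γ′, a′]` conjunct of `P_T4v3`) for every member of the family -/
  hN2 : ∀ ν, (releveled d hΓ' a' ha' ν).N2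
  /-- the endoscopic / automorphic side over the family of concrete witnesses (the cocompactness of the level that
  the witnesses need is the printed input's, `d.isCocompact_of_BHC hBHC hΓ'`) -/
  E : EndoscopicSideFam L (famW d hΓ' (d.isCocompact_of_BHC hBHC hΓ') a' ha')
  /-- the Tier-3 endoscopic inputs, realised on the family face -/
  inputs : EndoscopicInputs E.toC7Face

-- (v0.2) no global instance attribute: `fL` `nL` `cL` are supplied by `letI` where needed

/-- **The cocompactness of the family datum's level is the printed input's** (v0.16; PROVED): `d.isCocompact_of_BHC hBHC
hΓ'` — the former field `hcc` of v0.15, now derived, so that `Z.hcc` reads as before in `exists_famW_P` / `concl_of_v3`. -/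
theorem Line2DatumV3.hcc (d : Tier4.TargetData F₀ E₀)
    {hBHC : Lit.BorelHarishChandra1962_Thm11_8_cocompact_hdef E₀ d.H d.τ₀ d.C} (Z : Line2DatumV3 d hBHC) :
    d.IsCocompact Z.Γ' :=
  d.isCocompact_of_BHC hBHC Z.hΓ'

/-- **The line's full datum: the family datum TOGETHER WITH its weight-shifted branch on the family face** — the
object whose existence is L2.4′ below; exactly v0.12's `Line2Inputs` with the family face for the fixed-witness face
(the interpolation place `𝔭 | p` of `E′⁺` split in `E′`, the coefficient ring `O`, the branch datum `S` of the four lines). -/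
structure Line2InputsV3 (d : Tier4.TargetData F₀ E₀)
    (hBHC : Lit.BorelHarishChandra1962_Thm11_8_cocompact_hdef E₀ d.H d.τ₀ d.C) extends Line2DatumV3 d hBHC where
  /-- the interpolation place `𝔭 | p` of `E′⁺`, split in `E′` -/
  𝔭 : E.toC7Face.Place
  split : E.toC7Face.IsSplit 𝔭
  /-- the coefficient ring `O` of the four branch elements -/
  O : BranchCoefficients
  /-- the weight-shifted branch datum of the four lines on the family face -/
  S : WeightShiftedBranch E.toC7Face 𝔭 O

/-- **L2.7 — (P) on line L2 for the line's family datum** (PROVED from L2.0 and L2.6, i.e. from the kernel, exactly as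
v0.12's `P_of_line2`): the common twist `ν` of `Z.S` gives an admissible member with (R1) ∧ (R2), and the endoscopic
inputs turn it into (P) of the family face. -/
theorem P_of_line2_v3 (d : Tier4.TargetData F₀ E₀)
    {hBHC : Lit.BorelHarishChandra1962_Thm11_8_cocompact_hdef E₀ d.H d.τ₀ d.C} (Z : Line2InputsV3 d hBHC) :
    letI := Z.fL; letI := Z.nL; letI := Z.cL
    Z.E.toC7Face.P := by
  letI := Z.fL; letI := Z.nL; letI := Z.cL
  obtain ⟨d', hd', hR1', hR2'⟩ := exists_datum_R1_R2 Z.E.toC7Face Z.inputs Z.𝔭 Z.split Z.O Z.S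
  exact P_of_R1_R2 Z.E.toC7Face Z.inputs d' hd' hR1' hR2'

/-- **(P) for SOME member's concrete witness** (PROVED): the family face's `P` is `∃ ν, (famW … ν).P`
(`EndoscopicSideFam.toC7Face_P`, by cases on the Σ-datum) — the `∃ a'` of `P_T4v3` IS the `∃ ν` over the twist family. -/
theorem exists_famW_P (d : Tier4.TargetData F₀ E₀)
    {hBHC : Lit.BorelHarishChandra1962_Thm11_8_cocompact_hdef E₀ d.H d.τ₀ d.C} (Z : Line2InputsV3 d hBHC) :
    ∃ ν : Z.ι, (famW d Z.hΓ' Z.hcc Z.a' Z.ha' ν).P := by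
  letI := Z.fL; letI := Z.nL; letI := Z.cL
  exact Z.E.toC7Face_P.mp (P_of_line2_v3 d Z)

/-- **INPUT 1 of 2 (R-38 CLOSE FORM) — `Input_line2_inputs_v3` = the statement of the skeleton's ONE declared `sorry`,
`Line2.line2_inputs_v3`, VERBATIM, binders and all** (Skeleton.lean v0.16 L686–L689; the section variables
`{F₀ E₀ : Type} [Field F₀] [NumberField F₀] [IsGalois ℚ F₀] [IsCMField F₀] [Field E₀] [NumberField E₀] [IsGalois ℚ E₀]
[IsCMField E₀]` written out as the leading binders, exactly as the declaration elaborates).  INPUT CENSUS FLAG: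
**NOT A PRINT — open mathematics**: this is L2's costume (CENSUS.md §A–§B, §G, §J, §K: certified ≡ the per-datum
hypothesis of typer-1's `P_T4v3_of_concrete_cocompact` by `line2_inputs_v3_iff`, Witness/CostumeCertificate.lean,
HOME-only); its price is C-L2-CHARS (the DEFINITION of `chars` / `centralValue` / `rootNumber` from the forms, the §B
arithmetic).  It asserts nothing printed and is NOT a prover target. -/
def Input_line2_inputs_v3 : Prop :=
  ∀ {F₀ E₀ : Type} [Field F₀] [NumberField F₀] [IsGalois ℚ F₀] [IsCMField F₀]
    [Field E₀] [NumberField E₀] [IsGalois ℚ E₀] [IsCMField E₀]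
    (d : Tier4.TargetData F₀ E₀)
    (hBHC : Lit.BorelHarishChandra1962_Thm11_8_cocompact_hdef E₀ d.H d.τ₀ d.C),
    Nonempty (Line2InputsV3 d hBHC)

/-- **The hypothesis of typer-1's `P_T4v3_of_concrete_cocompact` for every datum, from the ONE printed input** (PROVED
from the line; R-38 replay: the skeleton's proof with the hypothesis `h₁ : Input_line2_inputs_v3` in place of the sorried
name `line2_inputs_v3` — the only change): the level `Γ′`, the quadruple `a' ν` of the member with (P), its N2, the cocompactness of `Γ′` (the
printed input's, `Line2DatumV3.hcc`), and (P) for the concrete witness of the re-levelled datum at its own level on the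
canonical domain — which is `(famW … ν).P` by unfolding. -/
theorem concl_of_v3 (h₁ : Input_line2_inputs_v3) (d : Tier4.TargetData F₀ E₀)
    (hBHC : Lit.BorelHarishChandra1962_Thm11_8_cocompact_hdef E₀ d.H d.τ₀ d.C) :
    ∃ (Γ' : Set (Matrix (Fin 3) (Fin 3) E₀)) (hΓ' : d.IsLevel Γ') (a' : ∀ i : Fin 4, (Fin 2 → ℂ) → (↥(d.T i) → ℂ))
      (ha' : ∀ i, IsAlbaneseLift (d.T i) (d.Λ i) d.τ₀ d.C Γ' (a' i)),
      (d.relevel Γ' hΓ'.1 a' ha').N2 ∧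
      ∃ hcc : (d.relevel Γ' hΓ'.1 a' ha').IsCocompact Γ',
        ((d.relevel Γ' hΓ'.1 a' ha').concreteWitness (d.relevel Γ' hΓ'.1 a' ha').isLevel_self
          (isDomain_dom _ (d.relevel Γ' hΓ'.1 a' ha').isLevel_self).subset_ball
          (isDomain_dom _ (d.relevel Γ' hΓ'.1 a' ha').isLevel_self).measurableSet
          ((d.relevel Γ' hΓ'.1 a' ha').residual_of_cocompact (d.relevel Γ' hΓ'.1 a' ha').isLevel_self hcc)).P := by
  obtain ⟨Z⟩ := h₁ d hBHC
  obtain ⟨ν, hν⟩ := exists_famW_P d Z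
  exact ⟨Z.Γ', Z.hΓ', Z.a' ν, Z.ha' ν, Z.hN2 ν, Z.hcc, hν⟩

/-- **INPUT 2 of 2 (R-38 CLOSE FORM) — `Input_hK_W42` = the type of the skeleton's displayed binder `hK` of
`Line2.target_L2v3`, VERBATIM** (Skeleton.lean v0.16 L716–L719): Borel–Harish-Chandra 1962 Thm 11.8 / Godement on the
frozen objects — the cocompactness of the ball action of every level — as lit-3's `Lit.BorelHarishChandra1962_Thm11_8_cocompact_hdef`
(Tier4/LitCompactness.lean), cite-only W42.  INPUT CENSUS FLAG: **a PRINT** (W42; the same display L4 carries as its `hK`),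
judged by the referees for faithfulness. -/
def Input_hK_W42 : Prop :=
  ∀ (E : Type) [Field E] [NumberField E] [IsCMField E] (H : Matrix (Fin 3) (Fin 3) E) (τ₀ : E →+* ℂ)
    (C : Matrix (Fin 3) (Fin 3) ℂ), Lit.BorelHarishChandra1962_Thm11_8_cocompact_hdef E H τ₀ C

/-- **THE CLOSE FORM OF LINE L2 (R-38, lead S15981): `Summit.Ventures.HodgeRepro.Tier4.P_T4v3` BY NAME from the two
named inputs, sorry-free** — the skeleton's assembly `target_L2v3` replayed with `hK : Input_hK_W42` (the displayed
print, unfolded to the binder it was) and `h₁ : Input_line2_inputs_v3` (the one declared sorry, now a hypothesis):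
`P_T4v3_of_concrete_cocompact` is typer-1's assembly of `P_T4v3` from (P) for the concrete witness of a chosen
N2-quadruple at a cocompact deeper level on the canonical domain; K1a–K1c and `hasEval_torsionPt` are consumed from
their landed modules, the witnesses from typer-1's ConcreteCocompact, the family face from typer-2's AutomorphicFam.
WHAT THIS CLAIMS (R-38 (4)): a sorry-free theorem `Inputs → P_T4v3` and NO claim on `P_T4v3` — `Input_line2_inputs_v3`
is NOT A PRINT.  HC_CM is NOT proved by anyone in this repository. -/
theorem target_L2v3_of_inputs (hK : Input_hK_W42) (h₁ : Input_line2_inputs_v3) : Tier4.P_T4v3 :=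
  Tier4.P_T4v3_of_concrete_cocompact fun _ E _ _ _ _ _ _ _ _ d => concl_of_v3 h₁ d (hK E d.H d.τ₀ d.C)


/-! ## Part IV (v0.15, ADDITIONS ONLY) — the `∃ a'` re-choice along a CM isogeny keeps the family's N2 (L2-p2's
N2Transfer p690799, consumed BY NAME) -/

/-- **The family's `hN2` field transfers along the CM isogeny `x·`** (`TargetData.N2_relevel_cm_mul`, Tier4/Line2/N2Transfer
p690799, t4-L2-p2): if every member of the family `a'` satisfies N2 at level `Γ′`, so does every member of the
pushed-forward family `σ ↦ σ x · a' ν i z σ` (Albanese lifts into the GIVEN lattices by `isAlbaneseLift_cm_mul`,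
IsogenyPushforwardCor p678577).  So the N2 clause of `line2_inputs_v3` is a statement about the ν-TWISTED CORNER LIFTS
themselves — the isogeny into `Λ i` neither creates nor destroys it (crit-1 S14206: «N2Transfer moves the N2 clause to
"N2 for the ν-twisted corner lifts", it does not remove it»).  Support only: nothing below `line2_inputs_v3` changes. -/
theorem hN2_cm_mul (d : Tier4.TargetData F₀ E₀) {Γ' : Set (Matrix (Fin 3) (Fin 3) E₀)} (hΓ' : d.IsLevel Γ')
    {ι : Type} (a' : ι → ∀ i : Fin 4, (Fin 2 → ℂ) → (↥(d.T i) → ℂ))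
    (ha' : ∀ ν i, IsAlbaneseLift (d.T i) (d.Λ i) d.τ₀ d.C Γ' (a' ν i))
    (hN2 : ∀ ν, (releveled d hΓ' a' ha' ν).N2) (x : F₀) (hx : IsIntegral ℤ x) (hx0 : x ≠ 0) :
    ∀ ν, (releveled d hΓ' (fun ν i z σ => σ.1 x * a' ν i z σ)
      (fun ν i => isAlbaneseLift_cm_mul (d.T i) (d.Λ i) (d.hΛ i) d.τ₀ d.C Γ' (a' ν i) x hx hx0 (ha' ν i)) ν).N2 :=
  fun ν => d.N2_relevel_cm_mul Γ' hΓ'.1 (a' ν) (ha' ν) x hx hx0 (hN2 ν)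
end Target

end Summit.Ventures.HodgeRepro.Tier4.Line2.CloseForm
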